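import Summits.QuantumFields.BalabanUV.Beta.GAN24.ArrowAnchorRealSchur
import Summits.QuantumFields.BalabanUV.Beta.GAN24.ArrowAnchorRealBorders
import Summits.QuantumFields.BalabanUV.Beta.GAN24.ArrowAnchorRealWeights

/-!
# `BalabanUV.Beta.GAN24.ArrowAnchorReal` — binder row G-an2-4 / (CONV-C), road P1-fibre, p1 row **P1-L10** `FibreStrip` ((I3′)), leaf-16's cut (M4)
# `L10-CUT-M4.md` (SKELETON-P1 A5 v0.3) row **F5 `ArrowAnchorReal`**: THE OUTER ANCHOR

NOT IN PRINT; OUR PROOF ATTEMPT.  HONEST FRAMING (cell contract, verbatim): «discharging `BetaPertH` makes Bałaban's UV stability UNCONDITIONAL — a real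
constructive-QFT result; it is NOT the continuum limit and NOT the Clay problem.»  HONEST DEPENDENCY (verbatim): «continuum YM on T⁴ ⇐ BetaPertH ∧ nine spine
estimates (0/9 proved); BetaPertH ⇐ (D1) ∧ (D4) ∧ CAP+tail; G-an2-4 gates asym, D1 and NE2/3/4.»  [folklore] assembly over F1b/F1c/F1e (`ArrowNorms.isUnit_bordered`,
`ArrowScaling`, `ArrowScalingInv.outer_blocks`) and leaf-12's five F5 parts (`ArrowAnchorRealCap/CapRadius` (iii)/(iii′), `…Borders` (ii), `…Weights` (ii′),
`ArrowSchurEntries` (iv), `ArrowAnchorRealSchur` (iv′)) — every input BY NAME; no cited fact, no wall binder, no `def … : Prop`; three numerical constants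
(`uO`, `vO`, `aR`).  NOT summit progress: nothing of (CONV-C)'s K-slot `GAN24.CombesThomas.ConvCK 3 Lc` is discharged here; 0 wall binders; NOT `BetaPertH`,
NOT continuum, NOT Clay.

## What is proved — ROW F5 OF THE CUT (every `D`, every `N ≥ 1`, every `q ∈ [−π, π]^D ∖ {0}`; `X = outerArrow N q (ofRealVec q)`)
* §1 the border legs of `ArrowNorms.isUnit_bordered`: `‖borU X‖ ≤ uO D`, `‖borV X‖ ≤ vO D` (Frobenius bounds `norm_colBorder_le` / `norm_rowBorder_le`; the squared
  moduli of the outer-scaled weights ARE the alias sums of `ArrowAnchorRealBorders`, which are O(1) UNIFORMLY in `N` and `q`);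
* §2 **`arrowAnchorReal : IsUnit (arrowMat X) ∧ ‖(arrowMat X)⁻¹‖ ≤ aR D`** with the explicit `N`- and `q`-free constant
  `aR D = 5/2 + (5/2·uO D + 1)·bCapO D·(vO D·5/2 + 1)` (blocks `t = 5/2` from F1e `outer_blocks`, Schur input `bCapO D` from `ArrowAnchorRealSchur.capS_outer_ape`);
  `exists_aR` = the same in row F7's ∃-constant packaging (`∃ A ≥ 0, ∀ N [NeZero N], ∀ q, … ≤ A`);
* §3 the (U1) corollary at the anchor: `det (trigPolySymbol (stencil (d+1)) pieceMatrix (ofRealVec q)) ≠ 0` (`ArrowScaling.det_ne_zero_of_isUnit_outerArrow`).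
Consumers: F7 `FibreDetStrip` (leaf-09-g6: the outer case of `FibreDetStripOfAnchors.of_strip` with `Gout q p := arrowMat (outerArrow N q p)`), F8, F9.
Unit `b2b-balaban-gan24-formalise-leaf-12` (G-an2-4 formalisation swarm, leaf prover 12, gen 7), 2026-08-20.  Value = kernel bookkeeping toward (I3′), NOT summit
progress.
-/

noncomputable section

open Matrix Complex Finset
open scoped Matrix.Norms.L2Operator BigOperators Real ComplexConjugate

namespace Summit.QuantumFields.BalabanUV.Beta.GAN24.ArrowAnchorReal

open Literature.MathematicalPhysics.QuantumFieldTheory.Balaban1983to89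
open Literature.MathematicalPhysics.QuantumFieldTheory.Balaban1983to89.Beta
open Literature.MathematicalPhysics.QuantumFieldTheory.Balaban1983to89.B4Strip (ofRealVec)
open Literature.Probability.LatticeModels (TorusSite)
open BlochFibreMatrix (stencil pieceMatrix)
open FibreInverseDecay (trigPolySymbol)
open FibreArrow (chiHat sflat boxS boxSs)
open AliasWeights (kfine)
open AliasWeightsSum (lapR)
open CapacitanceScalarBounds (gNormSq blockWt)
open ArrowOperator (Loc ArrowData arrowMat borU borV negLocW)
open ArrowNorms (capS colBorder rowBorder norm_colBorder_le norm_rowBorder_le isUnit_bordered)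
open ArrowScaling (outerArrow scaledArrow radO radO_pos sq_radO scaledArrow_wE scaledArrow_wG scaledArrow_wM scaledArrow_wQ det_ne_zero_of_isUnit_outerArrow)
open ArrowScalingInv (outer_blocks)
open ArrowSchurEntries (borU_eq_colBorder borV_eq_rowBorder arrowMat_eq)
open ArrowAnchorRealCapRadius (bCapO bCapO_pos)
open ArrowAnchorRealBorders (sum_wE_sq_le sum_wG_sq_le sum_wQ_sq_le sum_wM_sq_le)
open ArrowAnchorRealWeights (norm_sq_scaled norm_sq_scaled_wE norm_sq_scaled_wG norm_sq_scaled_wM norm_sq_boxSs outer_wE_summand outer_wG_summand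
  outer_wM_summand outer_wQ_summand)
open ArrowAnchorRealSchur (capS_outer_ape)

variable {D : ℕ} {N : ℕ} [NeZero N] {q : Fin D → ℝ}

/-! ## §1 The border legs: squared moduli of the outer-scaled weights and the two Frobenius bounds -/

/-- [folklore] `‖wE‖²` of the outer-scaled data at the anchor IS the `wE` summand of `ArrowAnchorRealBorders`. -/
theorem norm_sq_outer_wE (hN : 1 ≤ N) (hq : ∀ i, |q i| ≤ π) (hq0 : q ≠ 0) (m : TorusSite D N) (κ : Fin D) :
    ‖(outerArrow N q (ofRealVec q)).wE m κ‖ ^ 2 =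
      blockWt N q m * gNormSq N (kfine N q m κ) * ((N : ℝ) ^ 2 * lapR (kfine N q 0)) ^ 2 /
        ((N : ℝ) ^ (D + 2) * ((N : ℝ) ^ 2 * lapR (kfine N q m)) ^ 2) := by
  rw [show (outerArrow N q (ofRealVec q)).wE m κ = _ from scaledArrow_wE (radO N q) (radO N q 0) (ofRealVec q) m κ, norm_sq_scaled_wE hN,
    outer_wE_summand hN q m κ (R0 := radO N q 0 ^ 2) (pow_pos (radO_pos hq hq0 m) 2)]
  simp only [sq_radO]

/-- [folklore] `‖wG‖²` of the outer-scaled data at the anchor IS the `wG` summand of `ArrowAnchorRealBorders`. -/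
theorem norm_sq_outer_wG (hN : 1 ≤ N) (hq : ∀ i, |q i| ≤ π) (hq0 : q ≠ 0) (m : TorusSite D N) :
    ‖(outerArrow N q (ofRealVec q)).wG m‖ ^ 2 =
      blockWt N q m / (N : ℝ) ^ D * (((N : ℝ) ^ 2 * lapR (kfine N q 0)) ^ 3 / ((N : ℝ) ^ 2 * lapR (kfine N q m)) ^ 3) := by
  rw [show (outerArrow N q (ofRealVec q)).wG m = _ from scaledArrow_wG (radO N q) (radO N q 0) (ofRealVec q) m, norm_sq_scaled_wG hN,
    show ((N : ℝ) ^ 3 / radO N q m ^ 3) ^ 2 * (radO N q 0 ^ 3 / (N : ℝ) ^ 3) ^ 2 =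
      ((N : ℝ) ^ 6 / (radO N q m ^ 2) ^ 3) * ((radO N q 0 ^ 2) ^ 3 / (N : ℝ) ^ 6) by ring,
    outer_wG_summand hN q m (R0 := radO N q 0 ^ 2) (pow_pos (radO_pos hq hq0 m) 2)]
  simp only [sq_radO]

/-- [folklore] `‖wM‖²` of the outer-scaled data at the anchor IS the `wM` summand of `ArrowAnchorRealBorders`. -/
theorem norm_sq_outer_wM (hN : 1 ≤ N) (hq : ∀ i, |q i| ≤ π) (hq0 : q ≠ 0) (m : TorusSite D N) :
    ‖(outerArrow N q (ofRealVec q)).wM m‖ ^ 2 =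
      blockWt N q m / (N : ℝ) ^ D * (((N : ℝ) ^ 2 * lapR (kfine N q 0)) / ((N : ℝ) ^ 2 * lapR (kfine N q m))) := by
  rw [show (outerArrow N q (ofRealVec q)).wM m = _ from scaledArrow_wM (radO N q) (radO N q 0) (ofRealVec q) m, norm_sq_scaled_wM hN,
    show (radO N q 0 / (N : ℝ) ^ (D + 1)) ^ 2 * ((N : ℝ) / radO N q m) ^ 2 =
      (radO N q 0 ^ 2 / (N : ℝ) ^ (2 * D + 2)) * ((N : ℝ) ^ 2 / radO N q m ^ 2) by ring,
    outer_wM_summand hN q m (R0 := radO N q 0 ^ 2) (pow_pos (radO_pos hq hq0 m) 2)]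
  simp only [sq_radO]

omit [NeZero N] in
/-- [folklore] `‖wQ‖²` of the outer-scaled data at the anchor IS the `wQ` summand of `ArrowAnchorRealBorders`. -/
theorem norm_sq_outer_wQ [NeZero N] (hN : 1 ≤ N) (q : Fin D → ℝ) (m : TorusSite D N) (κ : Fin D) :
    ‖(outerArrow N q (ofRealVec q)).wQ m κ‖ ^ 2 = blockWt N q m * gNormSq N (kfine N q m κ) / (N : ℝ) ^ (D + 2) := by
  rw [show (outerArrow N q (ofRealVec q)).wQ m κ = _ from scaledArrow_wQ (radO N q) (radO N q 0) (ofRealVec q) m κ, norm_sq_scaled,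
    norm_sq_boxSs hN, one_pow, mul_one, outer_wQ_summand hN q m κ]

/-- [folklore] The local-row border of the outer-scaled data, squared and summed: `Σ_m Σ_s ‖negLocW X m s‖² ≤ CE + CG` (O(1) in `N`, `q`). -/
theorem sum_negLocW_sq_le (hN : 1 ≤ N) (hq : ∀ i, |q i| ≤ π) (hq0 : q ≠ 0) :
    ∑ m : TorusSite D N, ∑ s : Loc D, ‖negLocW (outerArrow N q (ofRealVec q)) m s‖ ^ 2 ≤
      D * (1 + ((D : ℝ) * π ^ 2) ^ 3 * ((5 : ℝ) ^ D - 1) / 64) + (1 + ((D : ℝ) * π ^ 2) ^ 4 * ((5 : ℝ) ^ D - 1) / 256) := by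
  have h : ∀ m : TorusSite D N, ∑ s : Loc D, ‖negLocW (outerArrow N q (ofRealVec q)) m s‖ ^ 2 =
      ∑ κ : Fin D, ‖(outerArrow N q (ofRealVec q)).wE m κ‖ ^ 2 + ‖(outerArrow N q (ofRealVec q)).wG m‖ ^ 2 := fun m => by
    rw [Fintype.sum_sum_type]
    simp [negLocW, ArrowData.locW, norm_neg]
  simp_rw [h, Finset.sum_add_distrib, norm_sq_outer_wE hN hq hq0, norm_sq_outer_wG hN hq hq0]
  exact add_le_add (sum_wE_sq_le hN hq hq0) (sum_wG_sq_le hN hq hq0)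

/-- [folklore] The border-row weights of the outer-scaled data, squared and summed: `Σ_m Σ_s ‖borW X m s‖² ≤ CQ + CM` (O(1) in `N`, `q`). -/
theorem sum_borW_sq_le (hN : 1 ≤ N) (hq : ∀ i, |q i| ≤ π) (hq0 : q ≠ 0) :
    ∑ m : TorusSite D N, ∑ s : Loc D, ‖(outerArrow N q (ofRealVec q)).borW m s‖ ^ 2 ≤
      D * (1 + (D : ℝ) * π ^ 2 * ((5 : ℝ) ^ D - 1) / 4) + (1 + ((D : ℝ) * π ^ 2) ^ 2 * ((5 : ℝ) ^ D - 1) / 16) := by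
  have h : ∀ m : TorusSite D N, ∑ s : Loc D, ‖(outerArrow N q (ofRealVec q)).borW m s‖ ^ 2 =
      ∑ κ : Fin D, ‖(outerArrow N q (ofRealVec q)).wQ m κ‖ ^ 2 + ‖(outerArrow N q (ofRealVec q)).wM m‖ ^ 2 := fun m => by
    rw [Fintype.sum_sum_type]
    simp [ArrowData.borW]
  simp_rw [h, Finset.sum_add_distrib, norm_sq_outer_wQ hN, norm_sq_outer_wM hN hq hq0]
  exact add_le_add (sum_wQ_sq_le hN hq) (sum_wM_sq_le hN hq hq0)

/-- **THE OUTER COLUMN-BORDER CONSTANT** `uO D := √(CE + CG)`, `CE = D(1 + (Dπ²)³(5^D−1)/64)`, `CG = 1 + (Dπ²)⁴(5^D−1)/256` (explicit; `N`-, `q`-free). -/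
def uO (D : ℕ) : ℝ :=
  Real.sqrt (D * (1 + ((D : ℝ) * π ^ 2) ^ 3 * ((5 : ℝ) ^ D - 1) / 64) + (1 + ((D : ℝ) * π ^ 2) ^ 4 * ((5 : ℝ) ^ D - 1) / 256))

/-- **THE OUTER ROW-BORDER CONSTANT** `vO D := √(CQ + CM)`, `CQ = D(1 + Dπ²(5^D−1)/4)`, `CM = 1 + (Dπ²)²(5^D−1)/16` (explicit; `N`-, `q`-free). -/
def vO (D : ℕ) : ℝ :=
  Real.sqrt (D * (1 + (D : ℝ) * π ^ 2 * ((5 : ℝ) ^ D - 1) / 4) + (1 + ((D : ℝ) * π ^ 2) ^ 2 * ((5 : ℝ) ^ D - 1) / 16))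

/-- [folklore] `0 ≤ uO D`. -/
theorem uO_nonneg (D : ℕ) : 0 ≤ uO D := Real.sqrt_nonneg _

/-- [folklore] `0 ≤ vO D`. -/
theorem vO_nonneg (D : ℕ) : 0 ≤ vO D := Real.sqrt_nonneg _

/-- [folklore] **COLUMN BORDER**: `‖borU X‖ ≤ uO D` at the outer anchor (Frobenius bound `ArrowNorms.norm_colBorder_le`). -/
theorem norm_borU_outer_le (hN : 1 ≤ N) (hq : ∀ i, |q i| ≤ π) (hq0 : q ≠ 0) : ‖borU (outerArrow N q (ofRealVec q))‖ ≤ uO D := by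
  rw [borU_eq_colBorder]
  exact (norm_colBorder_le _).trans (Real.sqrt_le_sqrt (sum_negLocW_sq_le hN hq hq0))

/-- [folklore] **ROW BORDER**: `‖borV X‖ ≤ vO D` at the outer anchor (Frobenius bound `ArrowNorms.norm_rowBorder_le`). -/
theorem norm_borV_outer_le (hN : 1 ≤ N) (hq : ∀ i, |q i| ≤ π) (hq0 : q ≠ 0) : ‖borV (outerArrow N q (ofRealVec q))‖ ≤ vO D := by
  rw [borV_eq_rowBorder]
  exact (norm_rowBorder_le _).trans (Real.sqrt_le_sqrt (sum_borW_sq_le hN hq hq0))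

/-! ## §2 Row F5: the outer anchor -/

/-- **THE OUTER ANCHOR CONSTANT** `aR D := 5/2 + (5/2·uO D + 1)·bCapO D·(vO D·5/2 + 1)` — `ArrowNorms.isUnit_bordered`'s `t + (tu + 1)·b·(vt + 1)` with
`t = 5/2` (F1d/F1e unit KKT blocks), `u = uO D`, `v = vO D` (§1), `b = bCapO D` (leaf-12's scaled-capacitance inverse bound); explicit, `N`- and `q`-free. -/
def aR (D : ℕ) : ℝ := 5 / 2 + (5 / 2 * uO D + 1) * bCapO D * (vO D * (5 / 2) + 1)

/-- [folklore] `0 < aR D`. -/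
theorem aR_pos (D : ℕ) : 0 < aR D := by
  have h1 := bCapO_pos D
  have h2 := uO_nonneg D
  have h3 := vO_nonneg D
  unfold aR
  positivity

/-- [folklore] `5/2 ≤ aR D` (the block constant alone). -/
theorem five_halves_le_aR (D : ℕ) : 5 / 2 ≤ aR D := by
  have h1 := bCapO_pos D
  have h2 := uO_nonneg D
  have h3 := vO_nonneg D
  unfold aR
  nlinarith [mul_nonneg (mul_nonneg (by positivity : (0 : ℝ) ≤ 5 / 2 * uO D + 1) h1.le) (by positivity : (0 : ℝ) ≤ vO D * (5 / 2) + 1)]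

/-- **ROW F5 OF THE CUT (M4) — THE OUTER ANCHOR**: for every `N ≥ 1` and every real momentum `q ∈ [−π, π]^D ∖ {0}`, the OUTER-SCALED alias-space
fibre operator at the anchor, `arrowMat (outerArrow N q (ofRealVec q))`, is invertible with `‖(arrowMat (outerArrow N q (ofRealVec q)))⁻¹‖ ≤ aR D`
(L2 operator norm), `aR D` explicit and INDEPENDENT of `N` and `q` — the outer scaling absorbs every power of `|q|` and of `N`.
[folklore] = F1b `ArrowNorms.isUnit_bordered` fed with F1e `outer_blocks` (t = 5/2), §1 (u, v) and `ArrowAnchorRealSchur.capS_outer_ape` (b = bCapO D). -/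
theorem arrowAnchorReal (hN : 1 ≤ N) (hq : ∀ i, |q i| ≤ π) (hq0 : q ≠ 0) :
    IsUnit (arrowMat (outerArrow N q (ofRealVec q))) ∧ ‖(arrowMat (outerArrow N q (ofRealVec q)))⁻¹‖ ≤ aR D := by
  have hS := capS_outer_ape hN hq hq0
  rw [arrowMat_eq, aR]
  exact isUnit_bordered _ _ _ (fun m => (outer_blocks hq hq0 m).1) (fun m => (outer_blocks hq hq0 m).2) (by norm_num) (norm_borU_outer_le hN hq hq0)
    (norm_borV_outer_le hN hq hq0) hS.1 hS.2

/-- [folklore] Invertibility alone. -/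
theorem isUnit_arrowMat_outer (hN : 1 ≤ N) (hq : ∀ i, |q i| ≤ π) (hq0 : q ≠ 0) : IsUnit (arrowMat (outerArrow N q (ofRealVec q))) :=
  (arrowAnchorReal hN hq hq0).1

/-- [folklore] The inverse bound alone. -/
theorem norm_inv_arrowMat_outer_le (hN : 1 ≤ N) (hq : ∀ i, |q i| ≤ π) (hq0 : q ≠ 0) :
    ‖(arrowMat (outerArrow N q (ofRealVec q)))⁻¹‖ ≤ aR D :=
  (arrowAnchorReal hN hq hq0).2

/-- [folklore] **∃-CONSTANT PACKAGING FOR ROW F7** (leaf-09-g6's `hF5` slot, journal l.3554): one `A ≥ 0`, uniform in `N ≥ 1` (`[NeZero N]`) and in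
`q ∈ [−π, π]^D ∖ {0}`, with `IsUnit (arrowMat (outerArrow N q (ofRealVec q))) ∧ ‖(arrowMat (outerArrow N q (ofRealVec q)))⁻¹‖ ≤ A` (witness `A = aR D`). -/
theorem exists_aR (D : ℕ) : ∃ A : ℝ, 0 ≤ A ∧ ∀ (N : ℕ) [NeZero N] (q : Fin D → ℝ), (∀ i, |q i| ≤ π) → q ≠ 0 →
    IsUnit (arrowMat (outerArrow N q (ofRealVec q))) ∧ ‖(arrowMat (outerArrow N q (ofRealVec q)))⁻¹‖ ≤ A :=
  ⟨aR D, (aR_pos D).le, fun _ _ _ hq hq0 => arrowAnchorReal NeZero.one_le hq hq0⟩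

/-! ## §3 The (U1) corollary at the anchor -/

/-- [folklore] **(U1) AT A NONZERO REAL BRILLOUIN MOMENTUM**: `det (trigPolySymbol (stencil (d+1)) pieceMatrix (ofRealVec q)) ≠ 0` for every `N ≥ 1` and every
`q ∈ [−π, π]^{d+1} ∖ {0}` (F1c's `det_ne_zero_of_isUnit_outerArrow` applied to `arrowAnchorReal`). -/
theorem det_ne_zero_anchor {d : ℕ} {N : ℕ} [NeZero N] (hN : 1 ≤ N) {q : Fin (d + 1) → ℝ} (hq : ∀ i, |q i| ≤ π) (hq0 : q ≠ 0) :
    (trigPolySymbol (stencil (d + 1)) (pieceMatrix (N := N)) (ofRealVec q)).det ≠ 0 :=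
  det_ne_zero_of_isUnit_outerArrow hq hq0 (ofRealVec q) (arrowAnchorReal hN hq hq0).1

end Summit.QuantumFields.BalabanUV.Beta.GAN24.ArrowAnchorReal

end
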